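import Summits.BirchSwinnertonDyer.Rank1Residual.Additive.KatoDescentRankOneCountJMatching
import Summits.BirchSwinnertonDyer.Rank1Residual.Additive.KatoDescentRankOneCountOfH2CountCM
import Summits.BirchSwinnertonDyer.Rank1Residual.Additive.KatoDescentRankOneCountContraOfFacts
import Summits.BirchSwinnertonDyer.Rank1Residual.Additive.KatoDescentLocPKummerLogExistence
import Summits.BirchSwinnertonDyer.Rank1Residual.Additive.KatoDescentKummerLogLinear
import HarnessLib

set_option autoImplicit false

/-!
# RECUT ASSEMBLY: stub 3 `stub_rankOneCountReadingKato` ON THE ALL-ADDITIVE / CM ROWS from FOUR named facts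
# {GZK, `IsNewformOf.level_eq_conductorNorm`, `Kato2004.thm12_4`, H2X} and TWO print displays {PR-INV, COUNT-X₀|add}
# (seat `bsd-cm-prr-ty1` g13, cell `bsd-cm`; theorems only: no definition, no named fact, no instance, no `sorry`)

Part 35 of the seat's kernel cut of stub 3 of the Kato–Perrin-Riou skeletons v4 (cruxes stmt-BirchSwinnertonDyer-19945 /
-19223); OFFER (A) of the seat, GO by planner D546.  The stub is `TorsionFree.RankOneCountReading IsKatoZetaDescentDatumOfContra
Kato2004.PRRatio`, whose body (`Additive/KatoDescentTorsionFreeReadings.lean` l.152–161, UNFOLDED here at `IsOf :=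
IsKatoZetaDescentDatumOfContra`, `PRRatio := Kato2004.PRRatio`) reads
  `∀ W [IsElliptic] [IsGloballyMinimal] p [Fact p.Prime] (D : KatoDescentDatum p) (ℒ : ℚ_[p]), W.analyticRank = 1 → p ≠ 2 →
   Addv W p → 0 ≤ padicValRat p W.j → ¬ p ∣ W.torsionOrder → Finite W.sha → IsOf W p D → PRRatio W p ℒ →
   Finite (coinvariants p D.H2) ∧ (ℒ ≠ 0 ↔ D.zetaIndex ≠ 0) ∧ ∀ m, D.zetaIndex = p ^ m * D.h2Card → ℒ.valuation = m + v_p #Ш[p^∞] + v_p Tam`.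
The v4 binder list is unrestricted at the bad `ℓ ≠ p`, while the count chain of Parts 30–34 (E13–E20: (R1-d), the strict Selmer
count, `KatoH2CountAt`, J-matching) is proved on the ALL-ADDITIVE rows (every bad `ℓ ≠ p` additive — every CM row).  THIS FILE
ASSEMBLES the recut form: the stub's body with ONE binder inserted after `Finite W.sha →`, the all-additive clause of Part 32
VERBATIM (`…_additive_of_facts`), resp. `W.HasCM` (`…_cm_of_facts`), from
* the named facts GZK (`rank_eq_analyticRank_of_analyticRank_le_one`), `IsNewformOf.level_eq_conductorNorm` (only for
  `P_p(p⁻¹) = 1` at the additive `p`), `Kato2004.thm12_4`, H2X (`Kato2004.exists_iwasawaH2Data_fineSelmerDual_embedding`), and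
* the displays PR-INV (A2's `hPRinv` VERBATIM) and COUNT-X₀|add (E20's `hX₀` VERBATIM: «on every all-additive rank-one row, for
  every pin `I`, every `J₀ : IwasawaH2Data W p κ γ I` and every injective `Λ`-linear `e₀ : (W.fineSelmerDualData κ hγ).X → J₀.H2` of
  finite cokernel, `KatoH2CountAt W p #(J₀.H2)_Γ`» = Kato (14.14.2) + (14.9.3) for the `X₀`-containing package in rank one).
MECHANISM (every link of the seat's chain is POINTWISE in `(W, p, κ, γ, I, J)`, so a row predicate `R W p` implying the all-additive
clause threads through — §2 `rankOneCountReading_of_facts_of_rowPred`, master form; §3 the two instances): A2's reduction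
`ContraCount.rankOneCountReading_contra_of_facts` (p637083) is re-run per row with its display COUNT (7) at `x = z₀` DERIVED in place —
conjunct (i) and LOG-EX from GZK (`rankOneCountReading_finite_of_gzk`, `logEx_of_gzk`), LOG-HOM (`logHom_display`), the Kummer-log
functional `φ` with `#ker φ = 1` and `[J.A : Λ·J.ι[x]] = p^{v(s) − v₀}` (Parts 9–12), E11's `v₀ = a + v(log_ω P)`, H2X's package `(J₀, e₀)`
over the pin (Imai finiteness by the theorem p686208), COUNT-X₀ at `J₀`, J-matching to the pinned `J` (Part 34), and Part 32's
`padicValNat_add_eq_of_katoH2CountAt`.  §1 `rankOneCountReading_additive_of_reading`: the recut is WEAKER than the v4 stub.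
HONEST LABEL: «stub 3 (v5-recut form) closes modulo 4 named facts {GZK, lev, thm12_4, H2X} + 2 print displays {PR-INV, COUNT-X₀|add}
on the all-additive / CM rows; the v4 stub 3 as registered is NOT closed; no recut performed» (planner D546); theorems only;
nothing is registered; nothing is asserted on 19945 / 19223; H2X, thm12_4, GZK, lev are hypotheses; PR-INV and COUNT-X₀ are
displayed, not proved; Kato's Main Conjecture and Perrin-Riou's conjecture are not touched; BSD is not proved for any curve.
References: [Kato2004Asterisque] Thm. 12.4 (p. 221), §13.9–13.12 (pp. 229–231), (14.9.1) (p. 239), (14.9.3) (p. 240), §14.14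
(14.14.1)–(14.14.2) (p. 243), Lemma 14.15, Prop. 14.16 (p. 244); [BurnsKuriharaSano2019] Thm. 7.3, Thm. 7.8 (d); [BlochKato1990]
Def. 3.10, Ex. 3.11; [GrossZagier1986] Thm. I.7.3; [Darmon2004] Thm. 3.22; [SilvermanATAEC1994] proof of Thm. II.10.5 (p. 172);
[Imai1975] Theorem (p. 12).
-/

noncomputable section

open scoped Classical NumberField BigOperators ContRepresentation

open WeierstrassCurve Field IsDedekindDomain NumberField Rat.HeightOneSpectrum Literature.NumberTheory.EllipticCurves
  Literature.NumberTheory.EllipticCurves.ModularForms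
  Literature.NumberTheory.EllipticCurves.Rank1Residual Literature.NumberTheory.EllipticCurves.Rank1Residual.Typed
  Literature.NumberTheory.EllipticCurves.Kato2004 Literature.NumberTheory.EllipticCurves.IwasawaAlgebra
  Literature.NumberTheory.EllipticCurves.Kato2004.EulerSystemValues
  Literature.NumberTheory.GaloisRepresentations Literature.NumberTheory.GaloisRepresentations.DiscreteGaloisModule
open WeierstrassCurve (galH1Primary kummerMapTorsion)
open Summit.BirchSwinnertonDyer.BirchSwinnertonDyer.Theorems.CongruentShaFreeCutKatoDescentDatumOfH2
  Summit.BirchSwinnertonDyer.BirchSwinnertonDyer.Theorems.CongruentShaFreeCutKatoKummerLogTorsion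
  Summit.BirchSwinnertonDyer.BirchSwinnertonDyer.Theorems.TowerTorsionFiniteOrdinary
open Summit.BirchSwinnertonDyer.Rank1Residual Summit.BirchSwinnertonDyer.Rank1Residual.Additive
  Summit.BirchSwinnertonDyer.Rank1Residual.Additive.ContraCount Summit.BirchSwinnertonDyer.Rank1Residual.Additive.LocPKummer
  Summit.BirchSwinnertonDyer.Rank1Residual.Additive.GlobalKummer

namespace Summit.BirchSwinnertonDyer.Rank1Residual.Additive.StrictCount

/-! ## §0 Two `p`-adic valuation identities (A2's private helpers, re-proved) -/

/-- A `p`-adic number of norm `1` has valuation `0`. [folklore] -/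
theorem valuation_eq_zero_of_norm_eq_one' {p : ℕ} [Fact p.Prime] {w : ℚ_[p]} (hw : ‖w‖ = 1) : w.valuation = 0 := by
  have hw0 : w ≠ 0 := fun h => by rw [h, norm_zero] at hw; exact zero_ne_one hw
  rw [Padic.norm_eq_zpow_neg_valuation hw0] at hw
  have hp : (1 : ℝ) < p := by exact_mod_cast (Fact.out : p.Prime).one_lt
  have := (zpow_right_injective₀ (zero_lt_one.trans hp) hp.ne') (hw.trans (zpow_zero _).symm)
  simpa using this

/-- `v(a·b/c/d²) = v a + v b − v c − 2·v d` for non-zero `p`-adic numbers. [folklore] -/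
theorem valuation_mul_div_div_sq' {p : ℕ} [Fact p.Prime] {a b c d : ℚ_[p]} (ha : a ≠ 0) (hb : b ≠ 0) (hc : c ≠ 0)
    (hd : d ≠ 0) :
    (a * b / c / d ^ 2).valuation = a.valuation + b.valuation - c.valuation - 2 * d.valuation := by
  rw [div_eq_mul_inv, div_eq_mul_inv, Padic.valuation_mul (mul_ne_zero (mul_ne_zero ha hb) (inv_ne_zero hc))
      (inv_ne_zero (pow_ne_zero 2 hd)), Padic.valuation_mul (mul_ne_zero ha hb) (inv_ne_zero hc),
    Padic.valuation_mul ha hb, Padic.valuation_inv, Padic.valuation_inv, Padic.valuation_pow]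
  ring

/-! ## §1 The recut is weaker than the v4 stub -/

/-- **The v4 stub implies its all-additive recut** (one extra hypothesis, otherwise the body VERBATIM): sanity link for the
planner's diff. [cite: Kato2004Asterisque, (14.9.3) (p. 240), §14.14 (p. 243), Prop. 14.16 (p. 244)] -/
theorem rankOneCountReading_additive_of_reading
    (h : TorsionFree.RankOneCountReading IsKatoZetaDescentDatumOfContra Kato2004.PRRatio) :
    ∀ (W : WeierstrassCurve ℚ) [W.IsElliptic] [W.IsGloballyMinimal] (p : ℕ) [Fact p.Prime]
      (D : KatoDescentDatum p) (ℒ : ℚ_[p]),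
      W.analyticRank = 1 → p ≠ 2 → Addv W p → 0 ≤ padicValRat p W.j → ¬ p ∣ W.torsionOrder →
      Finite W.sha →
      (∀ v ∈ W.badPlaces (𝓞 ℚ), ((Rat.HeightOneSpectrum.primesEquiv v : Nat.Primes) : ℕ) ≠ p →
        W.HasAdditiveReductionAt v) →
      IsKatoZetaDescentDatumOfContra W p D → Kato2004.PRRatio W p ℒ →
      Finite (coinvariants p D.H2) ∧ (ℒ ≠ 0 ↔ D.zetaIndex ≠ 0) ∧
        ∀ m : ℕ, D.zetaIndex = p ^ m * D.h2Card →
          ℒ.valuation = (m : ℤ) +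
            padicValNat p (Nat.card (AddCommGroup.primaryComponent W.sha p)) +
            padicValNat p W.tamagawaProduct :=
  fun W _ _ p _ D ℒ hr hp2 hadd hj htors hsha _ hD hℒ ↦ h W p D ℒ hr hp2 hadd hj htors hsha hD hℒ

/-! ## §2 The master assembly: stub 3 over ANY row predicate `R` implying the all-additive clause -/

section Assembly

/-- **STUB 3 OVER A ROW PREDICATE `R W p` from {GZK, `IsNewformOf.level_eq_conductorNorm`, `Kato2004.thm12_4`, H2X} + {PR-INV,
COUNT-X₀|R}.**  For any `R : WeierstrassCurve ℚ → ℕ → Prop` implying, on the rows, Part 32's all-additive clause (`hR`; e.g. the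
clause itself, §3, or `W.HasCM`, Part 33), the conclusion is the body of `TorsionFree.RankOneCountReading IsKatoZetaDescentDatumOfContra
Kato2004.PRRatio` (`KatoDescentTorsionFreeReadings.lean` l.152–161) with ONE binder `R W p →` inserted after `Finite W.sha →`.  `hPRinv`
is A2's display PR-INV verbatim; `hX₀` is Part 34's display COUNT-X₀ with `R W p →` in the slot of its all-additive clause.  Proof = A2's
reduction per row (second PRRatio witness from the admissible body of `z₀ = P.eH D.z`, K1's bottom-layer position `c₁ • proj₀ z₀ = c₂ •
proj₀ y′`, LOG-EX/LOG-HOM as theorems, PR-INV), with COUNT (7) at `x = z₀` DERIVED: `φ` the Kummer-log functional of the pinned package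
(`#ker φ = 1` by `p ∤ #W(ℚ)_tors`), `[J.A : Λ·J.ι[z₀]] = p^{v(s) − v₀}`, `v₀ = a + v(log_ω P)` (E11), and `v_p #(J.H2)_Γ + a = v_p
#Ш[p^∞] + v_p Tam + v(log_ω P)` from COUNT-X₀|R at H2X's `(J₀, e₀)` over the pin (Imai finiteness by theorem), J-matched to the pinned
`J` (Part 34) and read by Part 32's `padicValNat_add_eq_of_katoH2CountAt` with `Σ` from `hR`.  CONDITIONAL: nothing asserted; the v4
stub (unrestricted rows) is NOT closed by this theorem.
[cite: Kato2004Asterisque, Thm. 12.4 (p. 221), §13.9 (p. 230), (14.9.1) (p. 239), (14.9.3) (p. 240), §14.14 (14.14.1)–(14.14.2) (p. 243), Lemma 14.15 and Prop. 14.16 (p. 244)]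
[cite: BurnsKuriharaSano2019, Thm. 7.3 (p. 29) and Thm. 7.8 (d) (p. 30)] [cite: BlochKato1990, Def. 3.10 and Ex. 3.11]
[cite: GrossZagier1986, Thm. I.7.3] [cite: Darmon2004, Thm. 3.22] [cite: Imai1975, Theorem (p. 12)] -/
theorem rankOneCountReading_of_facts_of_rowPred (R : WeierstrassCurve ℚ → ℕ → Prop)
    (hR : ∀ (W : WeierstrassCurve ℚ) [W.IsElliptic] [W.IsGloballyMinimal] (p : ℕ) [Fact p.Prime], R W p →
      ∀ v ∈ W.badPlaces (𝓞 ℚ), ((Rat.HeightOneSpectrum.primesEquiv v : Nat.Primes) : ℕ) ≠ p → W.HasAdditiveReductionAt v)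
    (hGZK : rank_eq_analyticRank_of_analyticRank_le_one)
    (hlev : ∀ (N : ℕ) [NeZero N], IsNewformOf.level_eq_conductorNorm (N := N))
    (h12 : Kato2004.thm12_4) (hH2X : exists_iwasawaH2Data_fineSelmerDual_embedding)
    (hPRinv : ∀ (W : WeierstrassCurve ℚ) [W.IsElliptic] [W.IsGloballyMinimal] (p : ℕ) [Fact p.Prime]
      (ℒ₁ ℒ₂ : ℚ_[p]), Kato2004.PRRatio W p ℒ₁ → Kato2004.PRRatio W p ℒ₂ → ∃ w : ℚ_[p], ‖w‖ = 1 ∧ ℒ₂ = w * ℒ₁)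
    (hX₀ : ∀ (W : WeierstrassCurve ℚ) [W.IsElliptic] [W.IsGloballyMinimal] (p : ℕ) [Fact p.Prime],
      letI : ContinuousSMul ℤ_[p] (W.tateModule p) := TateModule.continuousSMul_padicInt
      ∀ (κ : ZpExtension ℚ p) (γ : absoluteGaloisGroup ℚ), κ.IsCyclotomic → (hγ : κ.IsTopGenerator γ) →
        ∀ (I : IwasawaH1Data W p κ γ) (J₀ : IwasawaH2Data W p κ γ I)
          (e₀ : (W.fineSelmerDualData κ hγ).X →ₗ[IwasawaAlgebra p] J₀.H2),
          W.analyticRank = 1 → p ≠ 2 → Addv W p → 0 ≤ padicValRat p W.j → ¬ p ∣ W.torsionOrder → Finite W.sha →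
          R W p →
          Function.Injective e₀ → Finite (J₀.H2 ⧸ LinearMap.range e₀) →
          KatoH2CountAt W p (Nat.card (coinvariants p J₀.H2))) :
    ∀ (W : WeierstrassCurve ℚ) [W.IsElliptic] [W.IsGloballyMinimal] (p : ℕ) [Fact p.Prime]
      (D : KatoDescentDatum p) (ℒ : ℚ_[p]),
      W.analyticRank = 1 → p ≠ 2 → Addv W p → 0 ≤ padicValRat p W.j → ¬ p ∣ W.torsionOrder →
      Finite W.sha →
      R W p →
      IsKatoZetaDescentDatumOfContra W p D → Kato2004.PRRatio W p ℒ →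
      Finite (coinvariants p D.H2) ∧ (ℒ ≠ 0 ↔ D.zetaIndex ≠ 0) ∧
        ∀ m : ℕ, D.zetaIndex = p ^ m * D.h2Card →
          ℒ.valuation = (m : ℤ) +
            padicValNat p (Nat.card (AddCommGroup.primaryComponent W.sha p)) +
            padicValNat p W.tamagawaProduct := by
  intro W _ _ p _ D ℒ hr hp2 hadd hj htors hsha hRW hD hℒ
  have hall := hR W p hRW
  letI instC : ContinuousSMul ℤ_[p] (W.tateModule p) := TateModule.continuousSMul_padicInt
  letI instF : Module.Free ℤ_[p] (W.tateModule p) := W.module_free_tateModule_holds p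
  letI instFi : Module.Finite ℤ_[p] (W.tateModule p) := W.module_finite_tateModule_holds p
  have hpr : p.Prime := Fact.out
  -- the displays LOG-EX and LOG-HOM are theorems (Parts 7, 4)
  have hLogEx := logEx_of_gzk hGZK
  have hLogHom := ContraCount.logHom_display
  -- conjunct (i): from GZK alone (Part 8 §3)
  have hfinH2 : Finite (coinvariants p D.H2) := rankOneCountReading_finite_of_gzk hGZK W p D hr hsha hD
  -- the Mordell–Weil rank (Gross–Zagier–Kolyvagin)
  obtain ⟨hmw, -⟩ := hGZK W (by rw [hr])
  have hrank : W.mordellWeilRank = 1 := by rw [hmw, hr]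
  have hsha' : Finite (AddCommGroup.primaryComponent W.sha p) := by haveI := hsha; infer_instance
  -- the pin, the admissible class and its body
  obtain ⟨Pn, hadm, hH2⟩ := hD
  obtain ⟨hp', N', hN', f', hf', ι', q', Λ', hq', hZ', c', d₁', a', A', d'', hA', hc', hd', hdd', hR', z', x',
    hzeta', y', hy', qm, perRatio', e, u, n₁, n₂, n₃, n₄, σc, σd, σℓ, hqm, -, h₁, h₂, h₃, h₄, -, -, -, hper0',
    hper', he, hpos⟩ :=
    (Kato2004.isAdmissibleZetaClass_iff W p Pn.κ Pn.isCyclotomic Pn.I (Pn.eH D.z)).mp hadm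
  haveI : NeZero N' := hN'
  -- K1: the position clause at the bottom layer
  obtain ⟨c₁, c₂, hc₁, hc₂, hkey, hval⟩ := Pn.I.exists_proj_zero_smul_eq_of_position hf' c' d₁' a' A' d'' hq'
    hqm.ne' hper0' h₁ h₂ h₃ h₄ hR' σc σd σℓ he u hpos
  -- the generator `P` of the given witness (all its other data are discarded)
  obtain ⟨-, N, hN, f, -, -, -, -, -, -, c, d₁, a, A, d', -, -, -, -, -, -, -, -, K, hK, γK, -, IK, y, -, t, P,
    perRatio, -, hP, -, -⟩ := (Kato2004.prRatio_iff W p ℒ).mp hℒ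
  have hlogP := padicLogLocal_map_ne_zero_of_generates p hrank hP
  -- Kummer logarithms on the admissible side (LOG-EX)
  obtain ⟨t', ht'⟩ := hLogEx W p Pn.κ Pn.γ Pn.isCyclotomic Pn.isTopGenerator hr Pn.I y'
  obtain ⟨s, hs⟩ := hLogEx W p Pn.κ Pn.γ Pn.isCyclotomic Pn.isTopGenerator hr Pn.I (Pn.eH D.z)
  -- COUNT (7) at `x = z₀` DERIVED (in place of A2's display `hCount`): Thm. 12.4 (2) on the pin
  obtain ⟨hfg, ⟨htf, hrk⟩, -⟩ := h12 W p Pn.κ Pn.γ Pn.isCyclotomic Pn.isTopGenerator Pn.I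
  haveI := hfg
  haveI := htf
  haveI : Nontrivial Pn.I.H := by
    by_contra hnt
    rw [not_nontrivial_iff_subsingleton] at hnt
    have h0 : Module.rank (IwasawaAlgebra p) Pn.I.H = 0 := rank_subsingleton' _ _
    rw [hrk] at h0
    exact one_ne_zero h0
  haveI hfinJ : Finite (coinvariants p Pn.J.H2) := finite_coinvariants_H2_of_iwasawaH2Data W p Pn.J hrank hsha'
  -- the Kummer-log functional `φ`, `#ker φ = 1`, the index formula at `z₀`, conjunct (ii)
  obtain ⟨φ, v₀, hφ, -, hfinker, hφ0, hv₀⟩ := exists_kummerLog_range_eq W p Pn.J hrank hsha'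
  haveI := hfinker
  have hker : Nat.card (LinearMap.ker φ) = 1 :=
    kummerLog_injective_of_not_dvd_torsionOrder W p Pn.κ hrank hsha' htors φ hφ
  obtain ⟨hidxa, hidxb⟩ := natCard_quotient_ι_eq W p Pn.J φ hφ hφ0 hv₀ (Pn.eH D.z) hs
  have hii : s ≠ 0 ↔ Nat.card (Pn.J.A ⧸ (IwasawaAlgebra p) ∙ Pn.J.ι (Submodule.Quotient.mk (Pn.eH D.z))) ≠ 0 :=
    count_ii_of_iwasawaH2Data W p Pn.J hrank hsha' (Pn.eH D.z) hs
  -- the global Kummer class of `P`, E11's lattice exponent `a` with `v₀ = a + v(log_ω P)`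
  obtain ⟨xP, hxP⟩ := exists_forall_ofTopSubgroup_reduceH1Pk_eq_kummerMapTorsion W p (zsmul_pow_surjective W p) P
  obtain ⟨aP, haP, hv₀a⟩ :=
    exists_integralH1_eq_span_pow_smul_and_eq_add_valuation W p Pn.κ hrank hsha' htors hP hxP φ hφ hv₀
  -- H2X's package `(J₀, e₀)` over THIS pin (Imai finiteness by theorem), COUNT-X₀ at `J₀`, J-matched to `Pn.J`
  have hfix := finite_fixedPoints_kerSubgroup_inf_decomp W p hj Pn.κ Pn.isCyclotomic (primePlace p)
    (coe_primesEquiv_primePlace p)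
  obtain ⟨J₀, e₀, he₀, hfin₀⟩ := hH2X W p Pn.κ Pn.γ Pn.isTopGenerator (primePlace p) hp2 Pn.isCyclotomic
    (coe_primesEquiv_primePlace p) hfix Pn.I
  haveI : Finite (coinvariants p J₀.H2) := finite_coinvariants_H2_of_iwasawaH2Data W p J₀ hrank hsha'
  have hcountJ : KatoH2CountAt W p (Nat.card (coinvariants p Pn.J.H2)) :=
    (katoH2CountAt_iff_of_pinned_of_embedding W p Pn.isTopGenerator Pn.J hH2 J₀ e₀ he₀ hfin₀).mpr
      (hX₀ W p Pn.κ Pn.γ Pn.isCyclotomic Pn.isTopGenerator Pn.I J₀ e₀ hr hp2 hadd hj htors hsha hRW he₀ hfin₀)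
  -- Part 32: `v_p #(J.H2)_Γ + a = v_p #Ш[p^∞] + v_p Tam + v(log_ω P)` (Σ = the bad places ≠ v_p, all additive)
  obtain ⟨Q, hQp, hQadd, hQbad⟩ := exists_finset_badPlaces_ne W p hall
  have hcnt := padicValNat_add_eq_of_katoH2CountAt W p hp2 hadd hrank hsha' htors hP hxP Q hQp hQadd hQbad haP hcountJ
  -- conjunct (iii) in `s`-currency
  have hiii : ∀ m : ℕ, Nat.card (Pn.J.A ⧸ (IwasawaAlgebra p) ∙ Pn.J.ι (Submodule.Quotient.mk (Pn.eH D.z))) =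
      p ^ m * Nat.card (coinvariants p Pn.J.H2) →
      s.valuation = (m : ℤ) + padicValNat p (Nat.card (AddCommGroup.primaryComponent W.sha p)) +
        padicValNat p W.tamagawaProduct +
        2 * (padicLogLocal W p
          (WeierstrassCurve.Affine.Point.map (W' := W.toAffine) (S := ℚ) (Algebra.ofId ℚ ℚ_[p]) P)).valuation := by
    intro m hm
    have hcard_ne : Nat.card (Pn.J.A ⧸ (IwasawaAlgebra p) ∙ Pn.J.ι (Submodule.Quotient.mk (Pn.eH D.z))) ≠ 0 := by
      rw [hm]
      exact mul_ne_zero (pow_ne_zero _ hpr.ne_zero) Nat.card_pos.ne'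
    have hs0 : s ≠ 0 := fun h0 ↦ hcard_ne (hidxb h0)
    obtain ⟨hidx, hle⟩ := hidxa hs0
    have hkeyN : Nat.card (LinearMap.ker φ) * p ^ (s.valuation - v₀).toNat =
        p ^ m * Nat.card (coinvariants p Pn.J.H2) := by rw [← hidx, hm]
    rw [hker, one_mul] at hkeyN
    have hv := congrArg (padicValNat p) hkeyN
    rw [padicValNat.prime_pow, padicValNat.mul (pow_ne_zero _ hpr.ne_zero) Nat.card_pos.ne', padicValNat.prime_pow] at hv
    have hv' : ((s.valuation - v₀).toNat : ℤ) = (m : ℤ) + padicValNat p (Nat.card (coinvariants p Pn.J.H2)) := by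
      exact_mod_cast hv
    rw [Int.toNat_of_nonneg (sub_nonneg.mpr hle)] at hv'
    rw [hv₀a] at hv'
    linarith
  -- the admissible family is a second PRRatio witness
  set G : ℚ_[p] := padicLogLocal W p
    (WeierstrassCurve.Affine.Point.map (W' := W.toAffine) (S := ℚ) (Algebra.ofId ℚ ℚ_[p]) P) with hG
  set M : ℚ := q' * ratCuspFactor f' true c' d₁' a' A' d'' *
    ∏ ℓ ∈ (p * A').primeFactors, eulerFactorAtOne W N' ℓ with hM
  set ℒ' : ℚ_[p] := t' * ((perRatio' : ℚ) : ℚ_[p]) / ((M : ℚ) : ℚ_[p]) / G ^ 2 with hℒ'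
  have hℒ'w : Kato2004.PRRatio W p ℒ' :=
    (Kato2004.prRatio_iff W p ℒ').mpr ⟨hp', N', hN', f', hf', ι', q', Λ', hq', hZ', c', d₁', a', A', d'', hA',
      hc', hd', hdd', hR', z', x', hzeta', Pn.κ, Pn.isCyclotomic, Pn.γ, Pn.isTopGenerator, Pn.I, y', hy', t', P,
      perRatio', ht', hP, hper', by rw [hℒ', hM, hG]⟩
  -- witness independence (PR-INV)
  obtain ⟨w, hw, hℒw⟩ := hPRinv W p ℒ' ℒ hℒ'w hℒ
  -- linearity of the Kummer logarithm (LOG-HOM) on K1's identity, moved to `H¹(⊤, T_pW)`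
  have hkey' : c₁ • layerZeroToTop W p Pn.κ (Pn.I.proj 0 (Pn.eH D.z)) =
      c₂ • layerZeroToTop W p Pn.κ (Pn.I.proj 0 y') := by
    have h := congrArg (fun v => layerZeroToTop W p Pn.κ v) hkey
    simp only [map_smul] at h
    exact h
  have hst : (c₁ : ℚ_[p]) * s = (c₂ : ℚ_[p]) * t' := hLogHom W p _ _ c₁ c₂ s t' hkey' hs ht'
  -- the indices along the pin
  have hidx := zetaIndex_eq_natCard_pin Pn; have hh2 := h2Card_eq_natCard_pin Pn
  -- non-vanishing of the constants
  have hc₁Q : (c₁ : ℚ_[p]) ≠ 0 := PadicInt.coe_ne_zero.mpr hc₁; have hc₂Q : (c₂ : ℚ_[p]) ≠ 0 := PadicInt.coe_ne_zero.mpr hc₂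
  have hw0 : w ≠ 0 := fun h => by rw [h, norm_zero] at hw; exact zero_ne_one hw
  have hE : ∀ ℓ ∈ (p * A').primeFactors, eulerFactorAtOne W N' ℓ ≠ 0 := fun ℓ hℓ =>
    eulerFactorAtOne_ne_zero W hf' (Nat.prime_of_mem_primeFactors hℓ)
  have hM0 : M ≠ 0 := mul_ne_zero (mul_ne_zero hq' hR') (Finset.prod_ne_zero_iff.mpr hE)
  have hMQ : ((M : ℚ) : ℚ_[p]) ≠ 0 := by exact_mod_cast hM0
  have hlamQ : ((perRatio' : ℚ) : ℚ_[p]) ≠ 0 := by exact_mod_cast hper0'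
  have hst' : s = 0 ↔ t' = 0 := by
    constructor
    · intro h0; rw [h0, mul_zero] at hst; exact (mul_eq_zero.mp hst.symm).resolve_left hc₂Q
    · intro h0; rw [h0, mul_zero] at hst; exact (mul_eq_zero.mp hst).resolve_left hc₁Q
  have hℒ'C : ℒ' = t' * (((perRatio' : ℚ) : ℚ_[p]) / ((M : ℚ) : ℚ_[p]) / G ^ 2) := by
    rw [hℒ']; ring
  have hC0 : ((perRatio' : ℚ) : ℚ_[p]) / ((M : ℚ) : ℚ_[p]) / G ^ 2 ≠ 0 :=
    div_ne_zero (div_ne_zero hlamQ hMQ) (pow_ne_zero 2 hlogP)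
  have hℒ't : ℒ' = 0 ↔ t' = 0 := by
    rw [hℒ'C, mul_eq_zero, or_iff_left hC0]
  refine ⟨hfinH2, ?_, ?_⟩
  · -- conjunct (ii)
    rw [hidx, ← hii, hℒw, mul_ne_zero_iff]
    exact ⟨fun h hs0 => h.2 (hℒ't.mpr (hst'.mp hs0)), fun h => ⟨hw0, fun h' => h (hst'.mpr (hℒ't.mp h'))⟩⟩
  · -- conjunct (iii)
    intro m hm
    rw [hidx, hh2] at hm
    have hsv := hiii m hm
    have hcard : Nat.card (Pn.J.A ⧸ (IwasawaAlgebra p) ∙ Pn.J.ι (Submodule.Quotient.mk (Pn.eH D.z))) ≠ 0 := by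
      rw [hm]
      exact mul_ne_zero (pow_ne_zero _ (Fact.out : p.Prime).ne_zero) Nat.card_pos.ne'
    have hs0 : s ≠ 0 := hii.mpr hcard
    have ht0 : t' ≠ 0 := fun h => hs0 (hst'.mpr h); have hℒ'0 : ℒ' ≠ 0 := fun h => ht0 (hℒ't.mp h)
    rw [hℒw, Padic.valuation_mul hw0 hℒ'0, valuation_eq_zero_of_norm_eq_one' hw, zero_add]
    have hvℒ' : ℒ'.valuation = t'.valuation + padicValRat p perRatio' - padicValRat p M - 2 * G.valuation := by
      rw [hℒ', valuation_mul_div_div_sq' ht0 hlamQ hMQ hlogP, Padic.valuation_ratCast, Padic.valuation_ratCast]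
    have hvs : (c₁ : ℚ_[p]).valuation + s.valuation = (c₂ : ℚ_[p]).valuation + t'.valuation := by
      have := congrArg Padic.valuation hst
      rwa [Padic.valuation_mul hc₁Q hs0, Padic.valuation_mul hc₂Q ht0] at this
    have hMeq : M = q' * ratCuspFactor f' true c' d₁' a' A' d'' *
        ∏ ℓ ∈ A'.primeFactors.erase p, eulerFactorAtOne W N' ℓ := by
      rw [hM, prod_eulerFactorAtOne_primeFactors_mul_eq_of_addv W p hadd (hlev N' hf') hA']
    have hρ : padicValRat p (perRatio' / (q' * ratCuspFactor f' true c' d₁' a' A' d'' *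
        ∏ ℓ ∈ A'.primeFactors.erase p, eulerFactorAtOne W N' ℓ)) = padicValRat p perRatio' - padicValRat p M := by
      rw [← hMeq, padicValRat.div hper0' hM0]
    rw [hρ] at hval; rw [hvℒ']; linarith

end Assembly

/-! ## §3 The two recuts the cell's rows consume: all-additive (Part 32's clause) and CM (`W.HasCM`, Part 33) -/

section Recuts

/-- **STUB 3 ON THE ALL-ADDITIVE ROWS from {GZK, `IsNewformOf.level_eq_conductorNorm`, `Kato2004.thm12_4`, H2X} + {PR-INV,
COUNT-X₀|add}.**  The conclusion is the body of `TorsionFree.RankOneCountReading IsKatoZetaDescentDatumOfContra Kato2004.PRRatio`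
(`KatoDescentTorsionFreeReadings.lean` l.152–161) with ONE binder inserted after `Finite W.sha →` — Part 32's all-additive clause
VERBATIM; `hPRinv` = A2's PR-INV verbatim; `hX₀` = Part 34's COUNT-X₀ VERBATIM.  (§2 with `R :=` the clause, `hR := id`.)
CONDITIONAL: nothing asserted; the v4 stub (unrestricted rows) is NOT closed by this theorem; no recut is performed here.
[cite: Kato2004Asterisque, Thm. 12.4 (p. 221), §13.9 (p. 230), (14.9.1) (p. 239), (14.9.3) (p. 240), §14.14 (14.14.1)–(14.14.2) (p. 243), Prop. 14.16 (p. 244)]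
[cite: BurnsKuriharaSano2019, Thm. 7.3 (p. 29) and Thm. 7.8 (d) (p. 30)] [cite: GrossZagier1986, Thm. I.7.3] -/
theorem rankOneCountReading_additive_of_facts
    (hGZK : rank_eq_analyticRank_of_analyticRank_le_one)
    (hlev : ∀ (N : ℕ) [NeZero N], IsNewformOf.level_eq_conductorNorm (N := N))
    (h12 : Kato2004.thm12_4) (hH2X : exists_iwasawaH2Data_fineSelmerDual_embedding)
    (hPRinv : ∀ (W : WeierstrassCurve ℚ) [W.IsElliptic] [W.IsGloballyMinimal] (p : ℕ) [Fact p.Prime]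
      (ℒ₁ ℒ₂ : ℚ_[p]), Kato2004.PRRatio W p ℒ₁ → Kato2004.PRRatio W p ℒ₂ → ∃ w : ℚ_[p], ‖w‖ = 1 ∧ ℒ₂ = w * ℒ₁)
    (hX₀ : ∀ (W : WeierstrassCurve ℚ) [W.IsElliptic] [W.IsGloballyMinimal] (p : ℕ) [Fact p.Prime],
      letI : ContinuousSMul ℤ_[p] (W.tateModule p) := TateModule.continuousSMul_padicInt
      ∀ (κ : ZpExtension ℚ p) (γ : absoluteGaloisGroup ℚ), κ.IsCyclotomic → (hγ : κ.IsTopGenerator γ) →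
        ∀ (I : IwasawaH1Data W p κ γ) (J₀ : IwasawaH2Data W p κ γ I)
          (e₀ : (W.fineSelmerDualData κ hγ).X →ₗ[IwasawaAlgebra p] J₀.H2),
          W.analyticRank = 1 → p ≠ 2 → Addv W p → 0 ≤ padicValRat p W.j → ¬ p ∣ W.torsionOrder → Finite W.sha →
          (∀ v ∈ W.badPlaces (𝓞 ℚ), ((Rat.HeightOneSpectrum.primesEquiv v : Nat.Primes) : ℕ) ≠ p →
            W.HasAdditiveReductionAt v) →
          Function.Injective e₀ → Finite (J₀.H2 ⧸ LinearMap.range e₀) →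
          KatoH2CountAt W p (Nat.card (coinvariants p J₀.H2))) :
    ∀ (W : WeierstrassCurve ℚ) [W.IsElliptic] [W.IsGloballyMinimal] (p : ℕ) [Fact p.Prime]
      (D : KatoDescentDatum p) (ℒ : ℚ_[p]),
      W.analyticRank = 1 → p ≠ 2 → Addv W p → 0 ≤ padicValRat p W.j → ¬ p ∣ W.torsionOrder →
      Finite W.sha →
      (∀ v ∈ W.badPlaces (𝓞 ℚ), ((Rat.HeightOneSpectrum.primesEquiv v : Nat.Primes) : ℕ) ≠ p →
        W.HasAdditiveReductionAt v) →
      IsKatoZetaDescentDatumOfContra W p D → Kato2004.PRRatio W p ℒ →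
      Finite (coinvariants p D.H2) ∧ (ℒ ≠ 0 ↔ D.zetaIndex ≠ 0) ∧
        ∀ m : ℕ, D.zetaIndex = p ^ m * D.h2Card →
          ℒ.valuation = (m : ℤ) +
            padicValNat p (Nat.card (AddCommGroup.primaryComponent W.sha p)) +
            padicValNat p W.tamagawaProduct :=
  rankOneCountReading_of_facts_of_rowPred
    (fun W p ↦ ∀ v ∈ W.badPlaces (𝓞 ℚ), ((Rat.HeightOneSpectrum.primesEquiv v : Nat.Primes) : ℕ) ≠ p →
      W.HasAdditiveReductionAt v)
    (fun _ _ _ _ _ h ↦ h) hGZK hlev h12 hH2X hPRinv hX₀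

/-- **STUB 3 ON THE CM ROWS from {GZK, `IsNewformOf.level_eq_conductorNorm`, `Kato2004.thm12_4`, H2X} + {PR-INV, COUNT-X₀|CM}.**
The conclusion is the stub's body with the binder `W.HasCM →` inserted after `Finite W.sha →` (the binder of `X12.CMInertBad`; every
curve of 𝒞₇ has CM); `hX₀` = COUNT-X₀ with `W.HasCM →` in the slot of its all-additive clause (a WEAKER display than COUNT-X₀|add).
(§2 with `R W p := W.HasCM`, `hR :=` Part 33's `forall_badPlaces_hasAdditiveReductionAt_of_hasCM`.)  CONDITIONAL: nothing asserted;
the v4 stub is NOT closed; no recut is performed here. [cite: Kato2004Asterisque, Thm. 12.4 (p. 221), (14.9.3) (p. 240), §14.14 (p. 243), Prop. 14.16 (p. 244)]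
[cite: SilvermanATAEC1994, proof of Thm. II.10.5 (p. 172)] [cite: GrossZagier1986, Thm. I.7.3] -/
theorem rankOneCountReading_cm_of_facts
    (hGZK : rank_eq_analyticRank_of_analyticRank_le_one)
    (hlev : ∀ (N : ℕ) [NeZero N], IsNewformOf.level_eq_conductorNorm (N := N))
    (h12 : Kato2004.thm12_4) (hH2X : exists_iwasawaH2Data_fineSelmerDual_embedding)
    (hPRinv : ∀ (W : WeierstrassCurve ℚ) [W.IsElliptic] [W.IsGloballyMinimal] (p : ℕ) [Fact p.Prime]
      (ℒ₁ ℒ₂ : ℚ_[p]), Kato2004.PRRatio W p ℒ₁ → Kato2004.PRRatio W p ℒ₂ → ∃ w : ℚ_[p], ‖w‖ = 1 ∧ ℒ₂ = w * ℒ₁)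
    (hX₀ : ∀ (W : WeierstrassCurve ℚ) [W.IsElliptic] [W.IsGloballyMinimal] (p : ℕ) [Fact p.Prime],
      letI : ContinuousSMul ℤ_[p] (W.tateModule p) := TateModule.continuousSMul_padicInt
      ∀ (κ : ZpExtension ℚ p) (γ : absoluteGaloisGroup ℚ), κ.IsCyclotomic → (hγ : κ.IsTopGenerator γ) →
        ∀ (I : IwasawaH1Data W p κ γ) (J₀ : IwasawaH2Data W p κ γ I)
          (e₀ : (W.fineSelmerDualData κ hγ).X →ₗ[IwasawaAlgebra p] J₀.H2),
          W.analyticRank = 1 → p ≠ 2 → Addv W p → 0 ≤ padicValRat p W.j → ¬ p ∣ W.torsionOrder → Finite W.sha →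
          W.HasCM →
          Function.Injective e₀ → Finite (J₀.H2 ⧸ LinearMap.range e₀) →
          KatoH2CountAt W p (Nat.card (coinvariants p J₀.H2))) :
    ∀ (W : WeierstrassCurve ℚ) [W.IsElliptic] [W.IsGloballyMinimal] (p : ℕ) [Fact p.Prime]
      (D : KatoDescentDatum p) (ℒ : ℚ_[p]),
      W.analyticRank = 1 → p ≠ 2 → Addv W p → 0 ≤ padicValRat p W.j → ¬ p ∣ W.torsionOrder →
      Finite W.sha →
      W.HasCM →
      IsKatoZetaDescentDatumOfContra W p D → Kato2004.PRRatio W p ℒ →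
      Finite (coinvariants p D.H2) ∧ (ℒ ≠ 0 ↔ D.zetaIndex ≠ 0) ∧
        ∀ m : ℕ, D.zetaIndex = p ^ m * D.h2Card →
          ℒ.valuation = (m : ℤ) +
            padicValNat p (Nat.card (AddCommGroup.primaryComponent W.sha p)) +
            padicValNat p W.tamagawaProduct :=
  rankOneCountReading_of_facts_of_rowPred (fun W _ ↦ W.HasCM)
    (fun W _ _ p _ h ↦ forall_badPlaces_hasAdditiveReductionAt_of_hasCM W p h) hGZK hlev h12 hH2X hPRinv hX₀

end Recuts

end Summit.BirchSwinnertonDyer.Rank1Residual.Additive.StrictCount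

end
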